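import Mathlib
import HarnessLib
import Summits.Ventures.LatticeQCDFlow.Scaling.FluxTunnellingU1ExplicitLaw
import Summits.Ventures.LatticeQCDFlow.Scaling.U1ConvolutionLogConvex

/-!
# LatticeQCDFlow / Scaling — the explicit 2-d `U(1)` single-link tunnelling law at EVERY volume with the
# even-volume constant: `z₁(β)³·(μ_{β,L} ⊗ κ){Q ≠ Q'} ≤ 2e^{−2β}`, `L ≥ 2` odd or even

HONEST FRAMING: exact (Metropolis-corrected) sampling algorithms for lattice gauge theory; figures of merit are
autocorrelation/cost numbers at stated couplings and volumes; no continuum-physics claim.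

Venture `LatticeQCDFlow` (cell pub-lqcd), topic `Scaling`, FANOUT row 30 (lean-1, GEN-18) — OUR WORK, file 7 of the
explicit `U(1)` tunnelling programme.  Files 4–5 (`FluxTunnellingU1Explicit`, `FluxTunnellingU1ExplicitLaw`) carry
the hypothesis `L` EVEN because the moment chain `a_k = (K_wᵏ w)(1)` of `HaarConvolutionRatio` was log-convex only
in steps of two; file 6 (`FluxTunnellingU1AllVolumes`) removed the parity at the price of a factor
`c(β) = e^{−3/2}/(π max(1,β))`.  GEN-17's `U1ConvolutionLogConvex` (log-convexity at EVERY step) and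
`U1ConvolutionPowerPeak` (every power peaks at the identity) now give the even-volume constant at every volume:

* §1 `u1_iterate_twoStep_mono`, `u1_iterate_ratio_mono`, `u1_iterate_ratio_pow`, **`u1_pow_mul_iterate_le_all`**
  — the ratio chain through ALL indices: `z₁^{3n}·a_m ≤ a_{m+2n}` for every `m ≥ 1`;
* §2 **`u1_pow_mul_lintegral_le_all'`** — PATCH COMPARISON at every `L ≥ 2` with NO extra constant:
  `z₁(β)^{n+#P}·∫ f(U_·) dμ_{β,L} ≤ ∫ f ∏_{x∈P} w_β(g_x) dHaar^{⊗Λ}` (`#P ≤ 2n`, `2n + 2 ≤ L²`);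
  **`u1_pow_mul_measure_actionSum_ge_le_all'`** — patch-action tail `z₁^{n+#P}·μ{S_P ≥ c} ≤ e^{−βc}`;
* §3 **`u1_tunnelling_single_link_all'`** — for EVERY `L ≥ 2`, `β ≥ 0`, link `e₀` and `μ_{β,L}`-invariant Markov
  kernel changing only `e₀`: `z₁(β)³·(μ_{β,L} ⊗ κ){Q ≠ Q'} ≤ 2·e^{−2β}` — the factor `c(β)` of
  `u1_tunnelling_single_link_all` is gone; with `z₁(β) ≥ e^{−1/2}/(π√β)` this is `≤ 2π³e^{3/2}·β^{3/2}·e^{−2β}` at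
  every volume.

Elementary over the parents; nothing is cited as a fact; no `def`; no `sorry`.
-/

noncomputable section

namespace Summit.Ventures.LatticeQCDFlow.Theory2.Lattice.TwoDim

open MeasureTheory ProbabilityTheory Literature.MathematicalPhysics.QuantumFieldTheory
open Literature.MathematicalPhysics.QuantumLattice (u1Rep u1Rep_apply continuous_u1Rep)
open Summit.Ventures.LatticeQCDFlow.Theory2.HaarConv Summit.Ventures.LatticeQCDFlow.Theory2.Lattice.Flux
open scoped ENNReal

variable {L : ℕ}

/-! ## §1. The moment-ratio chain through all indices -/

/-- The moments `a_k = (K_wᵏ w)(1)` are non-zero and at most one (`β ≥ 0`). [ours] -/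
theorem u1_iterate_one_ne_zero_le_one {β : ℝ} (hβ : 0 ≤ β) (k : ℕ) :
    (haarConv (u1W β))^[k] (u1W β) 1 ≠ 0 ∧ (haarConv (u1W β))^[k] (u1W β) 1 ≠ ⊤ :=
  ⟨iterate_apply_ne_zero (measurable_u1W β) (u1W_ne_zero β) k 1,
    ne_top_of_le_ne_top ENNReal.one_ne_top (iterate_apply_le_one (measurable_u1W β) (u1W_le_one hβ) k 1)⟩

/-- **Two-step ratios are non-decreasing from the first index on**: `a_{m+2}·a_{m+1} ≤ a_{m+3}·a_m` for `m ≥ 1`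
(two consecutive log-convexity inequalities of `U1ConvolutionLogConvex`). [ours] -/
theorem u1_iterate_twoStep_mono {β : ℝ} (hβ : 0 ≤ β) (m : ℕ) (hm : 1 ≤ m) :
    (haarConv (u1W β))^[m + 2] (u1W β) 1 * (haarConv (u1W β))^[m + 1] (u1W β) 1 ≤
      (haarConv (u1W β))^[m + 3] (u1W β) 1 * (haarConv (u1W β))^[m] (u1W β) 1 := by
  set A : ℕ → ℝ≥0∞ := fun k => (haarConv (u1W β))^[k] (u1W β) 1 with hA
  obtain ⟨i, rfl⟩ : ∃ i, m = i + 1 := ⟨m - 1, by omega⟩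
  have h1 : A (i + 2) ^ 2 ≤ A (i + 1) * A (i + 3) := u1_iterate_logConvex hβ i
  have h2 : A (i + 3) ^ 2 ≤ A (i + 2) * A (i + 4) := u1_iterate_logConvex hβ (i + 1)
  have hc0 : A (i + 2) * A (i + 3) ≠ 0 :=
    mul_ne_zero (u1_iterate_one_ne_zero_le_one hβ _).1 (u1_iterate_one_ne_zero_le_one hβ _).1
  have hct : A (i + 2) * A (i + 3) ≠ ⊤ :=
    ENNReal.mul_ne_top (u1_iterate_one_ne_zero_le_one hβ _).2 (u1_iterate_one_ne_zero_le_one hβ _).2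
  have key : A (i + 2) * A (i + 3) * (A (i + 3) * A (i + 2)) ≤ A (i + 2) * A (i + 3) * (A (i + 4) * A (i + 1)) :=
    calc A (i + 2) * A (i + 3) * (A (i + 3) * A (i + 2)) = A (i + 2) ^ 2 * A (i + 3) ^ 2 := by ring
      _ ≤ (A (i + 1) * A (i + 3)) * (A (i + 2) * A (i + 4)) := mul_le_mul' h1 h2
      _ = A (i + 2) * A (i + 3) * (A (i + 4) * A (i + 1)) := by ring
  exact (ENNReal.mul_le_mul_iff_right hc0 hct).mp key

/-- **`a_3·a_m ≤ a_1·a_{m+2}` for every `m ≥ 1`** (the two-step ratio at `m` dominates the first one). [ours] -/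
theorem u1_iterate_ratio_mono {β : ℝ} (hβ : 0 ≤ β) (m : ℕ) (hm : 1 ≤ m) :
    (haarConv (u1W β))^[3] (u1W β) 1 * (haarConv (u1W β))^[m] (u1W β) 1 ≤
      (haarConv (u1W β))^[1] (u1W β) 1 * (haarConv (u1W β))^[m + 2] (u1W β) 1 := by
  set A : ℕ → ℝ≥0∞ := fun k => (haarConv (u1W β))^[k] (u1W β) 1 with hA
  induction m, hm using Nat.le_induction with
  | base => exact le_of_eq (mul_comm _ _)
  | succ m hm ih =>
    have hstep := u1_iterate_twoStep_mono hβ m hm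
    have hc0 : A m * A (m + 2) ≠ 0 :=
      mul_ne_zero (u1_iterate_one_ne_zero_le_one hβ _).1 (u1_iterate_one_ne_zero_le_one hβ _).1
    have hct : A m * A (m + 2) ≠ ⊤ :=
      ENNReal.mul_ne_top (u1_iterate_one_ne_zero_le_one hβ _).2 (u1_iterate_one_ne_zero_le_one hβ _).2
    have key : A m * A (m + 2) * (A 3 * A (m + 1)) ≤ A m * A (m + 2) * (A 1 * A (m + 1 + 2)) :=
      calc A m * A (m + 2) * (A 3 * A (m + 1)) = (A 3 * A m) * (A (m + 2) * A (m + 1)) := by ring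
        _ ≤ (A 1 * A (m + 2)) * (A (m + 3) * A m) := mul_le_mul' ih hstep
        _ = A m * A (m + 2) * (A 1 * A (m + 1 + 2)) := by ring
    exact (ENNReal.mul_le_mul_iff_right hc0 hct).mp key

/-- **`a_3ⁿ·a_m ≤ a_1ⁿ·a_{m+2n}`** for `m ≥ 1`. [ours] -/
theorem u1_iterate_ratio_pow {β : ℝ} (hβ : 0 ≤ β) (m : ℕ) (hm : 1 ≤ m) (n : ℕ) :
    ((haarConv (u1W β))^[3] (u1W β) 1) ^ n * (haarConv (u1W β))^[m] (u1W β) 1 ≤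
      ((haarConv (u1W β))^[1] (u1W β) 1) ^ n * (haarConv (u1W β))^[m + 2 * n] (u1W β) 1 := by
  set A : ℕ → ℝ≥0∞ := fun k => (haarConv (u1W β))^[k] (u1W β) 1 with hA
  induction n with
  | zero => simp
  | succ n ih =>
    have hmono := u1_iterate_ratio_mono hβ (m + 2 * n) (by omega)
    calc A 3 ^ (n + 1) * A m = A 3 * (A 3 ^ n * A m) := by ring
      _ ≤ A 3 * (A 1 ^ n * A (m + 2 * n)) := mul_le_mul' le_rfl ih
      _ = A 1 ^ n * (A 3 * A (m + 2 * n)) := by ring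
      _ ≤ A 1 ^ n * (A 1 * A (m + 2 * n + 2)) := mul_le_mul' le_rfl hmono
      _ = A 1 ^ (n + 1) * A (m + 2 * (n + 1)) := by
          rw [show m + 2 * (n + 1) = m + 2 * n + 2 by ring]; ring

/-- **The ratio chain through all indices**: `z₁^{3n}·a_m ≤ a_{m+2n}` for every `m ≥ 1`, `n`, `β ≥ 0`
(`z₁⁴ ≤ a_3`, `a_1 ≤ z₁`, and `u1_iterate_ratio_pow`; the even-start case is new). [ours] -/
theorem u1_pow_mul_iterate_le_all {β : ℝ} (hβ : 0 ≤ β) (m : ℕ) (hm : 1 ≤ m) (n : ℕ) :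
    (∫⁻ g, u1W β g ∂(haarProbability Circle)) ^ (3 * n) * (haarConv (u1W β))^[m] (u1W β) 1 ≤
      (haarConv (u1W β))^[m + 2 * n] (u1W β) 1 := by
  set z := ∫⁻ g, u1W β g ∂(haarProbability Circle) with hz
  have hw : Measurable (u1W β) := measurable_u1W β
  have hz0 : z ≠ 0 := by
    intro h
    have hae := (lintegral_eq_zero_iff hw).mp h
    obtain ⟨g, hg⟩ := hae.exists
    exact u1W_ne_zero β g hg
  have hzt : z ≠ ⊤ := ne_top_of_le_ne_top ENNReal.one_ne_top (by
    calc z ≤ ∫⁻ _, 1 ∂(haarProbability Circle) := lintegral_mono fun g => u1W_le_one hβ g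
      _ = 1 := by rw [lintegral_one, measure_univ])
  have h4 : z ^ (4 * n) ≤ ((haarConv (u1W β))^[3] (u1W β) 1) ^ n := by
    rw [pow_mul]; exact pow_le_pow_left' (pow_four_le_iterate_three hw (u1W_symm β)) n
  have h1 : ((haarConv (u1W β))^[1] (u1W β) 1) ^ n ≤ z ^ n := pow_le_pow_left' (iterate_one_le (u1W_le_one hβ)) n
  have hchain := u1_iterate_ratio_pow hβ m hm n
  have key : z ^ n * (z ^ (3 * n) * (haarConv (u1W β))^[m] (u1W β) 1) ≤
      z ^ n * (haarConv (u1W β))^[m + 2 * n] (u1W β) 1 :=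
    calc z ^ n * (z ^ (3 * n) * (haarConv (u1W β))^[m] (u1W β) 1)
        = z ^ (4 * n) * (haarConv (u1W β))^[m] (u1W β) 1 := by ring
      _ ≤ ((haarConv (u1W β))^[3] (u1W β) 1) ^ n * (haarConv (u1W β))^[m] (u1W β) 1 := by gcongr
      _ ≤ ((haarConv (u1W β))^[1] (u1W β) 1) ^ n * (haarConv (u1W β))^[m + 2 * n] (u1W β) 1 := hchain
      _ ≤ z ^ n * (haarConv (u1W β))^[m + 2 * n] (u1W β) 1 := by gcongr
  exact (ENNReal.mul_le_mul_iff_right (pow_ne_zero _ hz0) (ENNReal.pow_ne_top hzt)).mp key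

/-! ## §2. The patch comparison and the patch-action tail at every volume -/

/-- **PATCH COMPARISON FOR 2-d `U(1)` AT EVERY VOLUME** (`L ≥ 2`, `β ≥ 0`, no parity, no extra constant): for a patch
`P` of sites, `n` with `#P ≤ 2n` and `2n + 2 ≤ L²`, and `f ≥ 0` measurable depending only on the plaquettes of `P`,
`z₁(β)^{n+#P} · ∫ f(U_·) dμ_{β,L} ≤ ∫ f(g)·∏_{x∈P} w_β(g_x) dHaar^{⊗Λ}(g)`. [ours] -/
theorem u1_pow_mul_lintegral_le_all' [NeZero L] (hL : 2 ≤ L) {β : ℝ} (hβ : 0 ≤ β)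
    (P : Finset (Site 2 L)) (n : ℕ) (hPn : P.card ≤ 2 * n) (hn : 2 * n + 2 ≤ L ^ 2)
    {f : (Site 2 L → Circle) → ℝ≥0∞} (hfm : Measurable f)
    (hf : ∀ g g' : Site 2 L → Circle, (∀ x ∈ P, g x = g' x) → f g = f g') :
    z1 u1Rep β ^ (n + P.card) *
        ∫⁻ U, f (fun x => plaquetteHolonomy U x 0 1) ∂(wilsonMeasure (d := 2) (L := L) u1Rep β) ≤
      ∫⁻ g, f g * ∏ x ∈ P, u1W β (g x) ∂(Measure.pi fun _ : Site 2 L => haarProbability Circle) := by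
  classical
  set w : Circle → ℝ≥0∞ :=
    fun g => ENNReal.ofReal (Real.exp (-(β * (((1 : ℕ) : ℝ) - (u1Rep g).trace.re)))) with hwdef
  have hwu : u1W β = w := rfl
  have hw : Measurable w := measurable_oneWeight u1Rep continuous_u1Rep β
  have hws : ∀ g, w g⁻¹ = w g := u1_weight_symm β
  have hw0 : ∀ g, w g ≠ 0 := u1_weight_ne_zero β
  have hw1 : ∀ g, w g ≤ 1 := u1_weight_le_one hβ
  -- `L²` as a plain number
  obtain ⟨N, hN⟩ : ∃ N, L ^ 2 = N := ⟨_, rfl⟩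
  have hcardU : (Finset.univ : Finset (Site 2 L)).card = N := by
    rw [Finset.card_univ, Fintype.card_fun, ZMod.card, Fintype.card_fin, hN]
  rw [hN] at hn
  -- a puncture off `P`
  have hcard : P.card < (Finset.univ : Finset (Site 2 L)).card := by rw [hcardU]; omega
  obtain ⟨x₀, -, hx₀⟩ := Finset.exists_mem_notMem_of_card_lt_card hcard
  -- indices: `#R = N - 1 - #P = k + m`, `m = N - 1 - 2n ≥ 1`, `k = 2n - #P`
  set m := N - 1 - 2 * n with hm
  have hm1 : 1 ≤ m := by omega
  set k := 2 * n - P.card with hk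
  have hPsub : P ⊆ Finset.univ.erase x₀ := fun x hx =>
    Finset.mem_erase.mpr ⟨fun h => hx₀ (h ▸ hx), Finset.mem_univ _⟩
  have hRcard : ((Finset.univ.erase x₀) \ P).card = k + m := by
    rw [Finset.card_sdiff_of_subset hPsub, Finset.card_erase_of_mem (Finset.mem_univ _), hcardU]
    omega
  have hmn : m + 2 * n = N - 1 := by omega
  -- the three analytic inputs
  have hM : ∀ u, (haarConv w)^[((Finset.univ.erase x₀) \ P).card] w u ≤
      (haarConv w)^[m] w 1 * (∫⁻ g, w g ∂(haarProbability Circle)) ^ k := fun u => by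
    rw [hRcard, Function.iterate_add_apply]
    refine iterate_apply_le_pow hw (fun v => ?_) k u
    have h := u1_iterate_apply_le_apply_one hβ m v
    rw [hwu] at h
    exact h
  have hchain := u1_pow_mul_iterate_le_all hβ m hm1 n
  rw [hwu] at hchain
  have hZ : partitionFunction (d := 2) (L := L) u1Rep β = (haarConv w)^[m + 2 * n] w 1 := by
    unfold partitionFunction wilsonWeight
    rw [withDensity_apply _ MeasurableSet.univ, Measure.restrict_univ]
    simp_rw [weight_eq_prod_two u1Rep β]
    rw [lintegral_prod_weight_eq_iterate hL hw hws, hN, hmn]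
  have hZ0 : partitionFunction (d := 2) (L := L) u1Rep β ≠ 0 := by
    rw [hZ]; exact iterate_apply_ne_zero hw hw0 _ _
  have hZt : partitionFunction (d := 2) (L := L) u1Rep β ≠ ⊤ := by
    rw [hZ]; exact ne_top_of_le_ne_top ENNReal.one_ne_top (iterate_apply_le_one hw hw1 _ _)
  -- the Wilson integral as `Z⁻¹ · ∫ f(U_·) ∏ w(U_x) dHaar^E`
  have hfhol : Measurable fun U : GaugeConfig 2 L Circle => f (fun x => plaquetteHolonomy U x 0 1) :=
    hfm.comp (measurable_pi_lambda _ fun x => measurable_plaquetteHolonomy x)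
  have hdens : Measurable fun U : GaugeConfig 2 L Circle =>
      ENNReal.ofReal (Real.exp (-β * wilsonAction u1Rep U)) := by
    have h : (fun U : GaugeConfig 2 L Circle => ENNReal.ofReal (Real.exp (-β * wilsonAction u1Rep U))) =
        fun U => ∏ x, w (plaquetteHolonomy U x 0 1) := funext (weight_eq_prod_two u1Rep β)
    rw [h]
    exact Finset.measurable_prod _ fun x _ => hw.comp (measurable_plaquetteHolonomy x)
  have hint : ∫⁻ U, f (fun x => plaquetteHolonomy U x 0 1) ∂(wilsonMeasure (d := 2) (L := L) u1Rep β) =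
      (partitionFunction (d := 2) (L := L) u1Rep β)⁻¹ *
        ∫⁻ U, f (fun x => plaquetteHolonomy U x 0 1) * ∏ x, w (plaquetteHolonomy U x 0 1)
          ∂(Measure.pi fun _ : Edge 2 L => haarProbability Circle) := by
    unfold wilsonMeasure
    rw [lintegral_smul_measure]
    congr 1
    unfold wilsonWeight
    rw [lintegral_withDensity_eq_lintegral_mul _ hdens hfhol]
    refine lintegral_congr fun U => ?_
    rw [Pi.mul_apply, weight_eq_prod_two u1Rep β U, mul_comm]
  -- the sup bound on `∫ f(U_·) ∏ w(U_x)`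
  have hN' := lintegral_weight_mul_le hL hw hws x₀ P hx₀ hfm hf hM
  -- assemble
  rw [hint]
  have hkn : n + P.card + k = 3 * n := by omega
  calc z1 u1Rep β ^ (n + P.card) * ((partitionFunction (d := 2) (L := L) u1Rep β)⁻¹ *
        ∫⁻ U, f (fun x => plaquetteHolonomy U x 0 1) * ∏ x, w (plaquetteHolonomy U x 0 1)
          ∂(Measure.pi fun _ : Edge 2 L => haarProbability Circle))
      ≤ z1 u1Rep β ^ (n + P.card) * ((partitionFunction (d := 2) (L := L) u1Rep β)⁻¹ *
        ((haarConv w)^[m] w 1 * (∫⁻ g, w g ∂(haarProbability Circle)) ^ k *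
          ∫⁻ g, f g * ∏ x ∈ P, w (g x) ∂(Measure.pi fun _ : Site 2 L => haarProbability Circle))) := by
        gcongr
    _ = (partitionFunction (d := 2) (L := L) u1Rep β)⁻¹ *
        ((∫⁻ g, w g ∂(haarProbability Circle)) ^ (3 * n) * (haarConv w)^[m] w 1) *
          ∫⁻ g, f g * ∏ x ∈ P, w (g x) ∂(Measure.pi fun _ : Site 2 L => haarProbability Circle) := by
        rw [← hkn, pow_add]; unfold z1; ring
    _ ≤ (partitionFunction (d := 2) (L := L) u1Rep β)⁻¹ * (haarConv w)^[m + 2 * n] w 1 *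
          ∫⁻ g, f g * ∏ x ∈ P, w (g x) ∂(Measure.pi fun _ : Site 2 L => haarProbability Circle) := by
        gcongr
    _ = ∫⁻ g, f g * ∏ x ∈ P, w (g x) ∂(Measure.pi fun _ : Site 2 L => haarProbability Circle) := by
        rw [← hZ, ENNReal.inv_mul_cancel hZ0 hZt, one_mul]

/-- **PATCH-ACTION TAIL AT EVERY VOLUME** (2-d `U(1)`, `L ≥ 2`, `β ≥ 0`): with `S_P(U) = Σ_{x∈P} (1 − Re U_x)` and
`#P ≤ 2n`, `2n + 2 ≤ L²`: `z₁(β)^{n+#P} · μ_{β,L}{S_P ≥ c} ≤ e^{−βc}`. [ours] -/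
theorem u1_pow_mul_measure_actionSum_ge_le_all' [NeZero L] (hL : 2 ≤ L) {β : ℝ} (hβ : 0 ≤ β)
    (P : Finset (Site 2 L)) (n : ℕ) (hPn : P.card ≤ 2 * n) (hn : 2 * n + 2 ≤ L ^ 2) (c : ℝ) :
    z1 u1Rep β ^ (n + P.card) * wilsonMeasure (d := 2) (L := L) u1Rep β
        {U | c ≤ ∑ x ∈ P, (1 - ((plaquetteHolonomy U x 0 1 : Circle) : ℂ).re)} ≤
      ENNReal.ofReal (Real.exp (-(β * c))) := by
  classical
  set E : Set (Site 2 L → Circle) := {g | c ≤ ∑ x ∈ P, (1 - ((g x : Circle) : ℂ).re)} with hE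
  have hcont : Continuous fun g : Site 2 L → Circle => ∑ x ∈ P, (1 - ((g x : Circle) : ℂ).re) := by
    fun_prop
  have hEm : MeasurableSet E := measurableSet_le measurable_const hcont.measurable
  have hS : MeasurableSet {U : GaugeConfig 2 L Circle |
      c ≤ ∑ x ∈ P, (1 - ((plaquetteHolonomy U x 0 1 : Circle) : ℂ).re)} :=
    hEm.preimage (measurable_pi_lambda _ fun x => measurable_plaquetteHolonomy x)
  rw [← lintegral_indicator_one hS]
  have hind : ∀ U : GaugeConfig 2 L Circle,
      {U : GaugeConfig 2 L Circle | c ≤ ∑ x ∈ P, (1 - ((plaquetteHolonomy U x 0 1 : Circle) : ℂ).re)}.indicator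
        (1 : GaugeConfig 2 L Circle → ℝ≥0∞) U = E.indicator 1 (fun x => plaquetteHolonomy U x 0 1) := by
    intro U; simp only [Set.indicator_apply, Set.mem_setOf_eq, hE, Pi.one_apply]
  simp_rw [hind]
  have hdep : ∀ g g' : Site 2 L → Circle, (∀ x ∈ P, g x = g' x) →
      E.indicator (1 : (Site 2 L → Circle) → ℝ≥0∞) g = E.indicator 1 g' := by
    intro g g' hgg'
    have hsum : ∑ x ∈ P, (1 - ((g x : Circle) : ℂ).re) = ∑ x ∈ P, (1 - ((g' x : Circle) : ℂ).re) :=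
      Finset.sum_congr rfl fun x hx => by rw [hgg' x hx]
    have hmem : g ∈ E ↔ g' ∈ E := by simp only [hE, Set.mem_setOf_eq, hsum]
    by_cases hg : g ∈ E
    · rw [Set.indicator_of_mem hg, Set.indicator_of_mem (hmem.mp hg)]; rfl
    · rw [Set.indicator_of_notMem hg, Set.indicator_of_notMem (fun h => hg (hmem.mpr h))]
  refine (u1_pow_mul_lintegral_le_all' hL hβ P n hPn hn (measurable_one.indicator hEm) hdep).trans ?_
  calc ∫⁻ g, E.indicator 1 g * ∏ x ∈ P, u1W β (g x) ∂(Measure.pi fun _ : Site 2 L => haarProbability Circle)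
      ≤ ∫⁻ _, ENNReal.ofReal (Real.exp (-(β * c))) ∂(Measure.pi fun _ : Site 2 L => haarProbability Circle) := by
        refine lintegral_mono fun g => ?_
        by_cases hg : g ∈ E
        · rw [Set.indicator_of_mem hg, Pi.one_apply, one_mul]
          simp only [u1W_apply]
          rw [← ENNReal.ofReal_prod_of_nonneg (fun _ _ => (Real.exp_pos _).le), ← Real.exp_sum]
          refine ENNReal.ofReal_le_ofReal (Real.exp_le_exp.mpr ?_)
          rw [Finset.sum_neg_distrib, ← Finset.mul_sum]
          have hc : c ≤ ∑ x ∈ P, (1 - ((g x : Circle) : ℂ).re) := hg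
          exact neg_le_neg (mul_le_mul_of_nonneg_left hc hβ)
        · rw [Set.indicator_of_notMem hg, zero_mul]; exact bot_le
    _ = ENNReal.ofReal (Real.exp (-(β * c))) := by rw [lintegral_const, measure_univ, mul_one]

/-! ## §3. The single-link tunnelling law at every volume -/

/-- **PER-LINK THICK-PLAQUETTE TAIL AT EVERY VOLUME**: for the (one or two) plane positions `P` touched by a link
`e₀`, `z₁(β)³ · μ_{β,L}{S_P ≥ #P(1 − cos(π/#P))} ≤ e^{−2β}` (`L ≥ 2`, `β ≥ 0`). [ours] -/
theorem u1_pow_three_mul_measure_linkPatch_le_all' [NeZero L] (hL : 2 ≤ L) {β : ℝ} (hβ : 0 ≤ β)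
    (x₀ : Site 2 L) (e₀ : Edge 2 L) :
    z1 u1Rep β ^ 3 * wilsonMeasure (d := 2) (L := L) u1Rep β
        {U | ((Finset.univ.filter fun p : ZMod L × ZMod L => e₀ ∈ plaqLinks (planeSite x₀ 0 1 p) 0 1).card : ℝ) *
            (1 - Real.cos (Real.pi /
              (Finset.univ.filter fun p : ZMod L × ZMod L => e₀ ∈ plaqLinks (planeSite x₀ 0 1 p) 0 1).card)) ≤
          patchAction x₀ 0 1
            (Finset.univ.filter fun p : ZMod L × ZMod L => e₀ ∈ plaqLinks (planeSite x₀ 0 1 p) 0 1) U} ≤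
      ENNReal.ofReal (Real.exp (-(2 * β))) := by
  classical
  set P' : Finset (ZMod L × ZMod L) :=
    Finset.univ.filter fun p => e₀ ∈ plaqLinks (planeSite x₀ 0 1 p) 0 1 with hP'
  have hPne : P'.Nonempty := by
    refine ⟨((e₀.1 - x₀) 0, (e₀.1 - x₀) 1), Finset.mem_filter.mpr ⟨Finset.mem_univ _, ?_⟩⟩
    rw [(planeSite_eq_iff x₀ e₀.1 _).mpr rfl]
    obtain ⟨y, i⟩ := e₀
    fin_cases i <;> simp [plaqLinks]
  have hcard : P'.card ≤ 2 := card_touched_le_two x₀ e₀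
  have hthr : (P'.card : ℝ) * (1 - Real.cos (Real.pi / P'.card)) = 2 := by
    have h1 : 1 ≤ P'.card := hPne.card_pos
    interval_cases h : P'.card
    · simp [Real.cos_pi]; norm_num
    · simp [Real.cos_pi_div_two]
  set P : Finset (Site 2 L) := P'.image (planeSite x₀ 0 1) with hPdef
  have hinj : Set.InjOn (planeSite x₀ 0 1) (P' : Set (ZMod L × ZMod L)) := by
    intro p _ q _ hpq
    rw [(planeSite_eq_iff x₀ _ p).mp hpq, ← (planeSite_eq_iff x₀ _ q).mp rfl]
  have hPcard : P.card ≤ 2 * 1 := by rw [hPdef, Finset.card_image_of_injOn hinj]; omega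
  have hset : {U : GaugeConfig 2 L Circle | (P'.card : ℝ) * (1 - Real.cos (Real.pi / P'.card)) ≤
      patchAction x₀ 0 1 P' U} =
      {U | (2 : ℝ) ≤ ∑ x ∈ P, (1 - ((plaquetteHolonomy U x 0 1 : Circle) : ℂ).re)} := by
    ext U
    simp only [Set.mem_setOf_eq, hthr, patchAction, hPdef, Finset.sum_image hinj]
  have hn : 2 * 1 + 2 ≤ L ^ 2 := by nlinarith
  have htail := u1_pow_mul_measure_actionSum_ge_le_all' hL hβ P 1 hPcard hn 2
  have hz1 : z1 u1Rep β ≤ 1 := z1_le_one u1Rep U1.re_trace_u1Rep_le hβ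
  rw [hset]
  calc z1 u1Rep β ^ 3 * wilsonMeasure (d := 2) (L := L) u1Rep β
          {U | (2 : ℝ) ≤ ∑ x ∈ P, (1 - ((plaquetteHolonomy U x 0 1 : Circle) : ℂ).re)}
      ≤ z1 u1Rep β ^ (1 + P.card) * wilsonMeasure (d := 2) (L := L) u1Rep β
          {U | (2 : ℝ) ≤ ∑ x ∈ P, (1 - ((plaquetteHolonomy U x 0 1 : Circle) : ℂ).re)} :=
        mul_le_mul' (pow_le_pow_right_of_le_one' hz1 (by omega)) le_rfl
    _ ≤ ENNReal.ofReal (Real.exp (-(β * 2))) := htail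
    _ = ENNReal.ofReal (Real.exp (-(2 * β))) := by rw [mul_comm β 2]

/-- **THE EXPLICIT SINGLE-LINK TUNNELLING LAW FOR 2-d `U(1)` AT EVERY VOLUME** (`L ≥ 2` odd or even, `β ≥ 0`):
for every site `x₀`, link `e₀` and Markov kernel `κ` leaving `μ_{β,L}` invariant whose steps `μ_{β,L} ⊗ κ`-a.s.
change only `e₀`: `z₁(β)³ · (μ_{β,L} ⊗ κ){Q ≠ Q'} ≤ 2·e^{−2β}`, `Q` the topological charge of the plane through `x₀`
(the parity hypothesis of `u1_tunnelling_single_link` and the factor `c(β)` of `u1_tunnelling_single_link_all` are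
both gone). [ours] -/
theorem u1_tunnelling_single_link_all' [NeZero L] (hL : 2 ≤ L) {β : ℝ} (hβ : 0 ≤ β)
    (x₀ : Site 2 L) (e₀ : Edge 2 L)
    (κ : Kernel (GaugeConfig 2 L Circle) (GaugeConfig 2 L Circle)) [IsMarkovKernel κ]
    (hinv : κ.Invariant (wilsonMeasure (d := 2) (L := L) u1Rep β))
    (hloc : ∀ᵐ q ∂((wilsonMeasure (d := 2) (L := L) u1Rep β) ⊗ₘ κ), ∀ e, e ≠ e₀ → q.1 e = q.2 e) :
    z1 u1Rep β ^ 3 * ((wilsonMeasure (d := 2) (L := L) u1Rep β) ⊗ₘ κ)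
        {q | Flux.topCharge x₀ 0 1 q.1 ≠ Flux.topCharge x₀ 0 1 q.2} ≤
      2 * ENNReal.ofReal (Real.exp (-(2 * β))) := by
  classical
  set μW := wilsonMeasure (d := 2) (L := L) u1Rep β with hμW
  haveI : IsProbabilityMeasure μW := isProbabilityMeasure_wilsonMeasure u1Rep continuous_u1Rep β
  set P' : Finset (ZMod L × ZMod L) :=
    Finset.univ.filter fun p => e₀ ∈ plaqLinks (planeSite x₀ 0 1 p) 0 1 with hP'
  have hP : ∀ p, (∃ e ∈ plaqLinks (planeSite x₀ 0 1 p) 0 1, e ∈ ({e₀} : Finset (Edge 2 L))) → p ∈ P' := by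
    rintro p ⟨e, he, he0⟩
    rw [Finset.mem_singleton] at he0
    subst he0
    exact Finset.mem_filter.mpr ⟨Finset.mem_univ _, he⟩
  have hPne : P'.Nonempty := by
    refine ⟨((e₀.1 - x₀) 0, (e₀.1 - x₀) 1), Finset.mem_filter.mpr ⟨Finset.mem_univ _, ?_⟩⟩
    rw [(planeSite_eq_iff x₀ e₀.1 _).mpr rfl]
    obtain ⟨y, i⟩ := e₀
    fin_cases i <;> simp [plaqLinks]
  have hloc' : ∀ᵐ q ∂(μW ⊗ₘ κ), ∀ e ∉ ({e₀} : Finset (Edge 2 L)), q.1 e = q.2 e := by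
    filter_upwards [hloc] with q hq e he
    exact hq e (fun h => he (Finset.mem_singleton.mpr h))
  have hlaw := compProd_topCharge_ne_le_of_links_sharp x₀ 0 1 {e₀} hPne hP μW κ hinv hloc'
  have htail := u1_pow_three_mul_measure_linkPatch_le_all' hL hβ x₀ e₀
  calc z1 u1Rep β ^ 3 * (μW ⊗ₘ κ) {q | Flux.topCharge x₀ 0 1 q.1 ≠ Flux.topCharge x₀ 0 1 q.2}
      ≤ z1 u1Rep β ^ 3 * (2 * μW {U | (P'.card : ℝ) * (1 - Real.cos (Real.pi / P'.card)) ≤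
          patchAction x₀ 0 1 P' U}) := mul_le_mul' le_rfl hlaw
    _ = 2 * (z1 u1Rep β ^ 3 * μW {U | (P'.card : ℝ) * (1 - Real.cos (Real.pi / P'.card)) ≤
          patchAction x₀ 0 1 P' U}) := by ring
    _ ≤ 2 * ENNReal.ofReal (Real.exp (-(2 * β))) := mul_le_mul' le_rfl htail

end Summit.Ventures.LatticeQCDFlow.Theory2.Lattice.TwoDim

end
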